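import Mathlib
import HarnessLib
import Literature.MathematicalPhysics.QuantumLattice.FermiRG.BGM2006AppA3Reduction
import Summits.HubbardSuperconductivity.HubbardSuperconductivity.Theorems.KLProgrammeH10TwoPointLimitKlAnisoSupportChart
import Summits.HubbardSuperconductivity.HubbardSuperconductivity.Theorems.KLProgrammeH10TwoPointLimitKlAnisoAncestor
import Summits.HubbardSuperconductivity.HubbardSuperconductivity.Theorems.KLProgrammeH10TwoPointLimitKlAnisoOffUmklappCount
import Summits.HubbardSuperconductivity.HubbardSuperconductivity.Theorems.KLProgrammeKLRegimeSplitConsts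

/-!
# Route `KLProgramme` — K3 engine (stmt-HubbardSuperconductivity-20437), stub (b) (ℓ)/(I2), located item «ON-CLASS-KB» (U):
# transfer bricks — torus distance / pair angle, and «the fine chart centre is within (5/2)·w_k of the sign-absorbed coarse centre»

Cell gate-hubbard-kl, seat p4 g13.  Small facts used by the keyed on-class relative count (`…KlAnisoOnUmklappCount`): the pair angle `φ` (mod `π`)
is `1`-Lipschitz in each argument for the torus distance; a child's sector centre is within half a coarse sector of its dyadic ancestor's; congruent
coarse indices (`|O_k| ∣ (a′ − a − D)`) have centres within `|D|·w_k` on the torus; the half-turn index map (antipode, for `ψ⁻` legs) shifts fine and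
coarse centres by the same `±π` modulo `2π`; hence, with the ancestor localisation `exists_ancestor_near_of_overlap` (`|D| ≤ 2`),
`‖θ_{J′, ht c} − θ_{k, ht a}‖_{𝕋¹} ≤ (5/2)·w_k`.  Everything is PROVED; no definitions. [folklore]
-/

noncomputable section

namespace Summit.HubbardSuperconductivity.HubbardSuperconductivity.Theorems.PerturbedFermiCurve

set_option linter.dupNamespace false -- summit = problem name (single-conjunct summit), D-0017

open Classical
open Real Set Finset
open Literature.MathematicalPhysics.QuantumLattice Literature.MathematicalPhysics.QuantumLattice.BandSectorCounting
open Literature.MathematicalPhysics.QuantumLattice.FermiRG Literature.MathematicalPhysics.QuantumLattice.FermiRG.BGM2003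
open Literature.MathematicalPhysics.QuantumLattice.FermiRG.BGM2006AppA (signedMom_mem_sSector2003 sSector2003_subset_of_le)
open Literature.Probability.LatticeModels
open Summit.HubbardSuperconductivity.HubbardSuperconductivity.Theorems.DispersionFlow
open Summit.HubbardSuperconductivity.HubbardSuperconductivity.Theorems.KLRegimeSplit
open Summit.HubbardSuperconductivity.HubbardSuperconductivity.Theorems.KLProgrammeLegKernels
open Summit.HubbardSuperconductivity.HubbardSuperconductivity.Theorems.TorusFourierL2

/-! ## §1 Transfer bricks: torus distance, pair angle, child / ancestor / half-turn centre arithmetic -/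

/-- `‖−θ‖_{𝕋¹} = ‖θ‖_{𝕋¹}`. [folklore] -/
theorem torusDist_neg_eq (x : ℝ) : FermiRG.torusDist (-x) = FermiRG.torusDist x := by
  unfold FermiRG.torusDist
  rw [AddCircle.coe_neg, norm_neg]

/-- Subadditivity of the torus distance. [folklore] -/
theorem torusDist_add_le_add (a b : ℝ) : FermiRG.torusDist (a + b) ≤ FermiRG.torusDist a + FermiRG.torusDist b := by
  unfold FermiRG.torusDist; rw [AddCircle.coe_add]; exact norm_add_le _ _

/-- `φ(θ₁′, θ₂) ≤ φ(θ₁, θ₂) + ‖θ₁′ − θ₁‖_{𝕋¹}` (the pair angle is `1`-Lipschitz in each argument for the torus distance). [folklore] -/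
theorem pairAngle_le_add_torusDist_left (θ₁ θ₁' θ₂ : ℝ) :
    pairAngle θ₁' θ₂ ≤ pairAngle θ₁ θ₂ + FermiRG.torusDist (θ₁' - θ₁) := by
  have h1 : FermiRG.torusDist (θ₁' - θ₂) ≤ FermiRG.torusDist (θ₁ - θ₂) + FermiRG.torusDist (θ₁' - θ₁) := by
    have := torusDist_add_le_add (θ₁ - θ₂) (θ₁' - θ₁)
    rwa [show θ₁ - θ₂ + (θ₁' - θ₁) = θ₁' - θ₂ by ring] at this
  have h2 : FermiRG.torusDist (θ₁ - θ₂) ≤ FermiRG.torusDist (θ₁' - θ₂) + FermiRG.torusDist (θ₁' - θ₁) := by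
    have := torusDist_add_le_add (θ₁' - θ₂) (-(θ₁' - θ₁))
    rw [torusDist_neg_eq] at this
    rwa [show θ₁' - θ₂ + -(θ₁' - θ₁) = θ₁ - θ₂ by ring] at this
  unfold pairAngle
  rcases le_or_gt (FermiRG.torusDist (θ₁ - θ₂)) (π - FermiRG.torusDist (θ₁ - θ₂)) with h | h
  · rw [min_eq_left h]
    exact (min_le_left _ _).trans h1
  · rw [min_eq_right h.le]
    exact (min_le_right _ _).trans (by linarith)

/-- `φ` is symmetric. [folklore] -/
theorem pairAngle_symm (θ₁ θ₂ : ℝ) : pairAngle θ₁ θ₂ = pairAngle θ₂ θ₁ := by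
  rw [pairAngle, pairAngle, ← torusDist_neg_eq (θ₁ - θ₂), neg_sub]

/-- Moving both arguments: `φ(θ₁′, θ₂′) ≤ φ(θ₁, θ₂) + ‖θ₁′ − θ₁‖_{𝕋¹} + ‖θ₂′ − θ₂‖_{𝕋¹}`. [folklore] -/
theorem pairAngle_le_add_torusDist_two (θ₁ θ₁' θ₂ θ₂' : ℝ) :
    pairAngle θ₁' θ₂' ≤ pairAngle θ₁ θ₂ + FermiRG.torusDist (θ₁' - θ₁) + FermiRG.torusDist (θ₂' - θ₂) := by
  have h1 := pairAngle_le_add_torusDist_left θ₁ θ₁' θ₂'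
  have h2 := pairAngle_le_add_torusDist_left θ₂ θ₂' θ₁
  rw [pairAngle_symm θ₂' θ₁, pairAngle_symm θ₂ θ₁] at h2
  linarith

/-- **A child's centre is within half a coarse sector of its dyadic ancestor's centre**: for `k ≤ J′` and a fine index `c`,
`|θ_{J′,c} − θ_{k, c/2^{J′−k}}| ≤ w_k/2`. [folklore] -/
theorem abs_sectorCenter_sub_sectorCenter_div_le {k J' : ℕ} (hkJ : k ≤ J') (c : ℕ) :
    |sectorCenter J' c - sectorCenter k (c / 2 ^ (J' - k))| ≤ sectorWidth k / 2 := by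
  have hw : sectorWidth k = 2 ^ (J' - k) * sectorWidth J' := by
    have h1 := sectorCount_mul_sectorWidth k
    have h2 := sectorCount_mul_sectorWidth J'
    have hN : (sectorCount J' : ℝ) = 2 ^ (J' - k) * sectorCount k := by exact_mod_cast sectorCount_eq_pow_mul hkJ
    have hNk : (0 : ℝ) < sectorCount k := by exact_mod_cast sectorCount_pos k
    rw [hN] at h2
    refine mul_left_cancel₀ hNk.ne' ?_
    rw [h1]; linarith [h2]
  set P : ℕ := 2 ^ (J' - k) with hP
  have hP0 : 0 < P := by positivity
  have hdiv := Nat.div_add_mod c P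
  set a := c / P with ha
  set r := c % P with hr
  have hrlt : r < P := Nat.mod_lt _ hP0
  have hc : (c : ℝ) = a * P + r := by
    have : (P * a + r : ℕ) = c := hdiv
    have h' : (c : ℝ) = ((P * a + r : ℕ) : ℝ) := by rw [this]
    rw [h']; push_cast; ring
  have hPr : (P : ℝ) = (2 : ℝ) ^ (J' - k) := by rw [hP]; push_cast; rfl
  rw [BandSectorCounting.sectorCenter_eq, BandSectorCounting.sectorCenter_eq, hw, hc, ← hPr]
  have hw' : 0 < sectorWidth J' := sectorWidth_pos J'
  have hr0 : (0 : ℝ) ≤ r := Nat.cast_nonneg r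
  have hr1 : (r : ℝ) + 1 ≤ P := by exact_mod_cast hrlt
  have hrw : (r : ℝ) * sectorWidth J' + sectorWidth J' ≤ (P : ℝ) * sectorWidth J' := by nlinarith
  have e : sectorWidth J' / 2 + ((a : ℝ) * P + r) * sectorWidth J' - ((P : ℝ) * sectorWidth J' / 2 + (a : ℝ) * ((P : ℝ) * sectorWidth J')) =
      sectorWidth J' / 2 + (r : ℝ) * sectorWidth J' - (P : ℝ) * sectorWidth J' / 2 := by ring
  rw [e, abs_le]
  constructor <;> nlinarith

/-- **Congruent coarse indices have close centres**: if `|O_k| ∣ (a′ − a − D)` then `‖θ_{k,a′} − θ_{k,a}‖_{𝕋¹} ≤ |D|·w_k`. [folklore] -/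
theorem torusDist_sectorCenter_sub_le_of_dvd {k : ℕ} {a a' : ℕ} {D : ℤ} (h : (sectorCount k : ℤ) ∣ ((a' : ℤ) - a - D)) :
    FermiRG.torusDist (sectorCenter k a' - sectorCenter k a) ≤ |(D : ℝ)| * sectorWidth k := by
  obtain ⟨q, hq⟩ := h
  have hNw := sectorCount_mul_sectorWidth k
  have hdiff : sectorCenter k a' - sectorCenter k a = (D : ℝ) * sectorWidth k + q * (2 * π) := by
    rw [BandSectorCounting.sectorCenter_eq, BandSectorCounting.sectorCenter_eq, ← hNw]
    have hq' : ((a' : ℤ) : ℝ) - a - D = (sectorCount k : ℝ) * q := by exact_mod_cast hq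
    push_cast at hq'
    have : ((a' : ℝ) - a) = D + (sectorCount k : ℝ) * q := by linarith
    calc sectorWidth k / 2 + (a' : ℝ) * sectorWidth k - (sectorWidth k / 2 + (a : ℝ) * sectorWidth k)
        = ((a' : ℝ) - a) * sectorWidth k := by ring
      _ = (D + (sectorCount k : ℝ) * q) * sectorWidth k := by rw [this]
      _ = (D : ℝ) * sectorWidth k + q * ((sectorCount k : ℝ) * sectorWidth k) := by ring
  rw [hdiff, torusDist_add_int_mul_two_pi]
  refine (torusDist_le_abs_self _).trans (le_of_eq ?_)
  rw [abs_mul, abs_of_pos (sectorWidth_pos k)]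

/-- **The half-turn shifts cancel modulo `2π`**: applying the half-turn index map (same charge flag `s`) to a fine index `c` and a coarse index `a`
changes `θ_{J′,c} − θ_{k,a}` by a multiple of `2π`. [folklore] -/
theorem torusDist_halfTurn_centres_eq {k J' : ℕ} (s : Bool) {c : ℕ} (hc : c < sectorCount J') {a : ℕ} (ha : a < sectorCount k) (x : ℝ) :
    FermiRG.torusDist (sectorCenter J' (if s then c else if c < 2 ^ J' then c + 2 ^ J' else c - 2 ^ J') -
        sectorCenter k (if s then a else if a < 2 ^ k then a + 2 ^ k else a - 2 ^ k) + x) =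
      FermiRG.torusDist (sectorCenter J' c - sectorCenter k a + x) := by
  -- `θ_{n, j ± 2ⁿ} = θ_{n,j} ± π`
  have hshift : ∀ (n j : ℕ), j < sectorCount n →
      ∃ z : ℤ, sectorCenter n (if j < 2 ^ n then j + 2 ^ n else j - 2 ^ n) = sectorCenter n j + π + z * (2 * π) := by
    intro n j hj
    have hNw := sectorCount_mul_sectorWidth n
    have hπn : (2 : ℝ) ^ n * sectorWidth n = π := by
      have : (sectorCount n : ℝ) = 2 * 2 ^ n := by unfold sectorCount; push_cast; ring
      rw [this] at hNw; linarith
    by_cases hlt : j < 2 ^ n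
    · refine ⟨0, ?_⟩
      rw [if_pos hlt, BandSectorCounting.sectorCenter_eq, BandSectorCounting.sectorCenter_eq]; push_cast
      linear_combination hπn
    · refine ⟨-1, ?_⟩
      have hle : 2 ^ n ≤ j := not_lt.1 hlt
      rw [if_neg hlt, BandSectorCounting.sectorCenter_eq, BandSectorCounting.sectorCenter_eq]
      push_cast [Nat.cast_sub hle]
      linear_combination -hπn
  cases s
  · simp only [Bool.false_eq_true, ↓reduceIte]
    obtain ⟨z₁, hz₁⟩ := hshift J' c hc
    obtain ⟨z₂, hz₂⟩ := hshift k a ha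
    rw [hz₁, hz₂]
    have e : sectorCenter J' c + π + z₁ * (2 * π) - (sectorCenter k a + π + z₂ * (2 * π)) + x =
        (sectorCenter J' c - sectorCenter k a + x) + ((z₁ - z₂ : ℤ) : ℝ) * (2 * π) := by push_cast; ring
    rw [e, torusDist_add_int_mul_two_pi]
  · simp

/-- **The fine chart centre is within `(5/2)·w_k` of the sign-absorbed coarse centre**: if the fine index `c` (scale `J′ ≥ k`) has dyadic ancestor
congruent to `a + D` modulo `|O_k|` with `|D| ≤ 2`, then, after the same half-turn on both,
`‖θ_{J′,ht c} − θ_{k,ht a}‖_{𝕋¹} ≤ (5/2)·w_k`. [folklore] -/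
theorem torusDist_fineCentre_sub_coarseCentre_le {k J' : ℕ} (hkJ : k ≤ J') (s : Bool) {c : ℕ} (hc : c < sectorCount J') {a : ℕ}
    (ha : a < sectorCount k) {D : ℤ} (hD : |D| ≤ 2) (hdvd : (sectorCount k : ℤ) ∣ ((((c / 2 ^ (J' - k) : ℕ) : ℤ)) - a - D)) :
    FermiRG.torusDist (sectorCenter J' (if s then c else if c < 2 ^ J' then c + 2 ^ J' else c - 2 ^ J') -
        sectorCenter k (if s then a else if a < 2 ^ k then a + 2 ^ k else a - 2 ^ k)) ≤ 5 / 2 * sectorWidth k := by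
  have h0 := torusDist_halfTurn_centres_eq s hc ha 0
  rw [add_zero, add_zero] at h0
  rw [h0]
  have h1 := abs_sectorCenter_sub_sectorCenter_div_le hkJ c
  have h2 := torusDist_sectorCenter_sub_le_of_dvd hdvd
  have hD' : |(D : ℝ)| ≤ 2 := by exact_mod_cast hD
  have hw : 0 < sectorWidth k := sectorWidth_pos k
  have hsplit : sectorCenter J' c - sectorCenter k a =
      (sectorCenter J' c - sectorCenter k (c / 2 ^ (J' - k))) + (sectorCenter k (c / 2 ^ (J' - k)) - sectorCenter k a) := by ring
  rw [hsplit]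
  calc FermiRG.torusDist ((sectorCenter J' c - sectorCenter k (c / 2 ^ (J' - k))) + (sectorCenter k (c / 2 ^ (J' - k)) - sectorCenter k a))
      ≤ FermiRG.torusDist (sectorCenter J' c - sectorCenter k (c / 2 ^ (J' - k))) + FermiRG.torusDist (sectorCenter k (c / 2 ^ (J' - k)) - sectorCenter k a) :=
        torusDist_add_le_add _ _
    _ ≤ sectorWidth k / 2 + |(D : ℝ)| * sectorWidth k := add_le_add ((torusDist_le_abs_self _).trans h1) h2
    _ ≤ 5 / 2 * sectorWidth k := by nlinarith


end Summit.HubbardSuperconductivity.HubbardSuperconductivity.Theorems.PerturbedFermiCurve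

end
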